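import Summits.AtomisticToContinuum.Crystallization.Theorems.ExcessDecayLiouvilleRelaxationCoercive
import Summits.AtomisticToContinuum.Crystallization.Theorems.ExcessDecayLiouvilleSelfForce
import Summits.AtomisticToContinuum.Crystallization.Theorems.ExcessDecayLiouvilleKLipschitz
import Summits.AtomisticToContinuum.Crystallization.Theorems.ExcessDecayLiouvilleEquationRemainder

/-!
# Route `ExcessDecayLiouville`: the relaxed inner shift by contraction (relaxation, III)

Harmonic-replacement architecture for item `ExcessDecay` (stmt-AtomisticToContinuum-9334), nonlinear half.
For a slope `B` and a jump `s` (the inner-shift offset `a 0 − a 1` of an affine-plus-shift field) the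
**natural force** at the base site `t 0` of the homogeneously displaced two-lattice is

`Ψ_B(s) = Σ'_{q ≠ t 0} F((t 0 − q) + B(t 0 − q) + 𝟙_{S₁}(q) s)`  (`F(x) = h(|x|²)x`).

* `jumpField_haff`, `summable_natForce` : `Ψ_B(s)` is a displaced self-force sum of
  `ExcessDecayLiouvilleSelfForce` (summable);
* `norm_natForce_lin_le` : `‖Ψ_B(s') − Ψ_B(s) − M(s' − s)‖ ≤ C₇ (25/23)² (7200‖s'−s‖ + 2·10⁵(‖B‖ + ‖s‖)) ‖s'−s‖`
  (`M` the cross force-constant operator; force linearisation + `K`-Lipschitz bounds, bond by bond);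
* `exists_natForce_zero` : for `κ ≤ 1`, `‖B‖, ‖s₀‖ ≤ 10⁻¹⁰κ` and `‖Ψ_B(s₀)‖ ≤ 10⁻¹¹κ²` there is a jump `s`
  with `‖s − s₀‖ ≤ (4/κ)‖Ψ_B(s₀)‖` and `Ψ_B(s) = 0` (Banach fixed point for `s ↦ s − M⁻¹Ψ_B(s)`, with
  `‖M⁻¹‖ ≤ 2/κ` from `crossFC_coercive`).

All `[folklore]`; helper lemmas, nothing here closes an item.
-/

noncomputable section

namespace Summit.AtomisticToContinuum.Crystallization.Theorems.ExcessDecayLiouville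

open scoped BigOperators Topology InnerProductSpace RealInnerProductSpace Classical
open Literature.MathematicalPhysics.StatisticalMechanics
open Summit.AtomisticToContinuum.Crystallization.Theorems.PhononStabilityNegative

local notation "E3" => EuclideanSpace ℝ (Fin 3)

-- Local notation: the force-constant map `K(e)w = h(|e|²)w + 2⟪e,w⟫h′(|e|²)e` (`= forceConst e w`).
local notation3 "𝕂[" e "] " w:max =>
  (-((‖e‖ ^ 2)⁻¹) ^ 7 + ((‖e‖ ^ 2)⁻¹) ^ 4) • w + (2 * ⟪e, w⟫ * (7 * ((‖e‖ ^ 2)⁻¹) ^ 8 - 4 * ((‖e‖ ^ 2)⁻¹) ^ 5)) • e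
-- Local notation: the pair force `F(x) = h(|x|²) x`.
local notation3 "𝐅[" x "]" => ((-((‖x‖ ^ 2)⁻¹) ^ 7 + ((‖x‖ ^ 2)⁻¹) ^ 4) • x)
-- Local notation: the remainder `R(e, w) = F(e + w) − F(e) − K(e) w`.
local notation3 "ℛ[" e ", " w "]" => (𝐅[e + w] - 𝐅[e] - 𝕂[e] w)

section

variable {t : Fin 2 → E3} {A : E3 →L[ℝ] E3} {κ : ℝ} {B : E3 →L[ℝ] E3}

set_option quotPrecheck false in
-- Local notation: the operator row `(L v)(p)`.
local notation "𝕃" v:max " @ " p:max =>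
  tsum (fun q : Sites₀ t A => (if ((p : Sites₀ t A) : E3) ≠ q then 𝕂[((p : Sites₀ t A) : E3) - q] (v ((p : Sites₀ t A) : E3) - v q) else 0))

set_option quotPrecheck false in
-- Local notation: the cross force-constant operator `M = Σ'_{q ∈ S₁} K(t 0 − q)`.
local notation "𝐌ₓ" =>
  tsum (fun q : Sites₀ t A => (if (∃ z ∈ Λ₀, (q : E3) = t 1 + A z) then forceConst ((t 0 : E3) - q) else 0))

set_option quotPrecheck false in
-- Local notation: the natural force `Ψ_B(s)` at `t 0` of the two-lattice displaced by slope `B` and jump `s`.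
local notation "𝚿[" B ", " s "]" =>
  tsum (fun q : Sites₀ t A => (if (t 0 : E3) ≠ q then
    𝐅[((t 0 : E3) - q) + (B ((t 0 : E3) - q) + (if (∃ z ∈ Λ₀, (q : E3) = t 1 + A z) then s else 0))] else 0))

/-! ## The natural force as a displaced self-force -/

/-- The jump field `x ↦ B(x − t 0) − 𝟙_{S₁}(x) s` is affine-plus-shift with `a = (0, −s)`, `x₀ = t 0`. [folklore] -/
theorem jumpField_haff (hA : Adm₀ A) (hI : Inner₀ t A) (B : E3 →L[ℝ] E3) (s : E3) :
    ∀ (m : Fin 2) (z : E3), z ∈ Λ₀ →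
      (fun x : E3 => B (x - t 0) + (if (∃ z ∈ Λ₀, x = t 1 + A z) then -s else 0)) (t m + A z) =
        (![0, -s] : Fin 2 → E3) m + B (t m + A z - t 0) := by
  intro m z hz
  fin_cases m
  · have h0 : ¬ ∃ z' ∈ Λ₀, t 0 + A z = t 1 + A z' := fun ⟨z', hz', h⟩ => sublattice_ne hA hI hz hz' h
    simp only [Fin.zero_eta, Fin.isValue, Matrix.cons_val_zero]
    rw [if_neg h0, zero_add, add_zero]
  · have h1 : ∃ z' ∈ Λ₀, t 1 + A z = t 1 + A z' := ⟨z, hz, rfl⟩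
    simp only [Fin.mk_one, Fin.isValue, Matrix.cons_val_one, Matrix.cons_val_zero]
    rw [if_pos h1, add_comm]

/-- The bonds of the jump field at the base site: `aff(t 0) − aff(q) = B(t 0 − q) + 𝟙_{S₁}(q) s`. [folklore] -/
theorem jumpField_sub (hA : Adm₀ A) (hI : Inner₀ t A) (B : E3 →L[ℝ] E3) (s : E3) (q : E3) :
    (fun x : E3 => B (x - t 0) + (if (∃ z ∈ Λ₀, x = t 1 + A z) then -s else 0)) (t 0) -
      (fun x : E3 => B (x - t 0) + (if (∃ z ∈ Λ₀, x = t 1 + A z) then -s else 0)) q =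
      B (t 0 - q) + (if (∃ z ∈ Λ₀, q = t 1 + A z) then s else 0) := by
  have h0 : ¬ ∃ z' ∈ Λ₀, t 0 = t 1 + A z' := by
    rintro ⟨z', hz', h⟩
    exact sublattice_ne hA hI zero_mem_Λ₀ hz' (by simpa using h)
  simp only [h0, if_false, sub_self, map_zero, add_zero, zero_sub, map_sub]
  split_ifs <;> abel

/-- **The natural force is summable** (`‖B‖, ‖s‖ ≤ 1/50`). [folklore] -/
theorem summable_natForce (hA : Adm₀ A) (hI : Inner₀ t A) (hB : ‖B‖ ≤ 1 / 50) {s : E3} (hs : ‖s‖ ≤ 1 / 50) :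
    Summable (fun q : Sites₀ t A => (if (t 0 : E3) ≠ q then
      𝐅[((t 0 : E3) - q) + (B ((t 0 : E3) - q) + (if (∃ z ∈ Λ₀, (q : E3) = t 1 + A z) then s else 0))] else 0)) := by
  have ha : ‖(![0, -s] : Fin 2 → E3) 0 - (![0, -s] : Fin 2 → E3) 1‖ ≤ 1 / 50 := by simpa using hs
  have h := summable_dispForce hA hI
    (aff := fun x : E3 => B (x - t 0) + (if (∃ z ∈ Λ₀, x = t 1 + A z) then -s else 0))
    (jumpField_haff hA hI B s) ha hB ⟨t 0, t0_mem_sites⟩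
  refine h.congr fun q => ?_
  simp only []
  rw [jumpField_sub hA hI B s q]

/-! ## Linearisation of the natural force in the jump -/

/-- **One bond**: for `|e| ≥ 23/25`, `‖B‖ ≤ 1/200`, `‖s‖, ‖s'‖ ≤ 1/200`,
`‖F(e + Be + s') − F(e + Be + s) − K(e)(s' − s)‖ ≤ (25/23)² (7200 ‖s'−s‖ + 2·10⁵ (‖B‖ + ‖s‖)) ‖s'−s‖ · |e|⁻⁷`. [folklore] -/
theorem norm_bond_lin_le {e : E3} (he : 23 / 25 ≤ ‖e‖) (hB : ‖B‖ ≤ 1 / 200) {s s' : E3} (hs : ‖s‖ ≤ 1 / 200)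
    (hs' : ‖s'‖ ≤ 1 / 200) :
    ‖𝐅[e + (B e + s')] - 𝐅[e + (B e + s)] - 𝕂[e] (s' - s)‖ ≤
      (25 / 23 : ℝ) ^ 2 * (7200 * ‖s' - s‖ + 200000 * (‖B‖ + ‖s‖)) * ‖s' - s‖ * (‖e‖⁻¹) ^ 7 := by
  have he0 : 0 < ‖e‖ := by linarith
  have hBe : ‖B e‖ ≤ ‖e‖ / 200 := (B.le_opNorm e).trans (by nlinarith [norm_nonneg e])
  have ha : ‖B e + s‖ ≤ ‖e‖ / 200 + ‖s‖ := (norm_add_le _ _).trans (by linarith)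
  have ha' : ‖B e + s‖ ≤ ‖e‖ / 60 := by nlinarith
  have hd : ‖s' - s‖ ≤ 1 / 10 := (norm_sub_le _ _).trans (by linarith)
  -- the displaced bond
  have hea : (59 / 60) * ‖e‖ ≤ ‖e + (B e + s)‖ := by
    have := norm_sub_norm_le e (-(B e + s)); rw [sub_neg_eq_add, norm_neg] at this; linarith
  have hea9 : 9 / 10 ≤ ‖e + (B e + s)‖ := by linarith
  have hsplit : 𝐅[e + (B e + s')] - 𝐅[e + (B e + s)] - 𝕂[e] (s' - s) =
      ℛ[e + (B e + s), s' - s] + (𝕂[e + (B e + s)] (s' - s) - 𝕂[e] (s' - s)) := by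
    have e1 : e + (B e + s') = e + (B e + s) + (s' - s) := by abel
    rw [e1]; abel
  rw [hsplit]
  have h1 := norm_remainder_le hea9 hd
  have h2 := norm_forceConst_shift_sub_le (by linarith : 9 / 10 ≤ ‖e‖) (by linarith : ‖B e + s‖ ≤ ‖e‖ / 4) (s' - s)
  -- converting the inverse powers
  have hi0 : 0 ≤ ‖e‖⁻¹ := inv_nonneg.2 he0.le
  have hi1 : ‖e‖⁻¹ ≤ 25 / 23 := by rw [inv_le_comm₀ he0 (by norm_num)]; linarith
  have hiea : ‖e + (B e + s)‖⁻¹ ≤ 60 / 59 * ‖e‖⁻¹ := by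
    rw [inv_le_comm₀ (by linarith) (by positivity), mul_inv, inv_inv]
    have : (60 / 59 : ℝ)⁻¹ * ‖e‖ = 59 / 60 * ‖e‖ := by norm_num
    rw [this]; exact hea
  have hiea0 : 0 ≤ ‖e + (B e + s)‖⁻¹ := inv_nonneg.2 (by linarith)
  have hp9 : ‖e + (B e + s)‖⁻¹ ^ 9 ≤ (60 / 59 : ℝ) ^ 9 * (25 / 23) ^ 2 * ‖e‖⁻¹ ^ 7 := by
    calc ‖e + (B e + s)‖⁻¹ ^ 9 ≤ (60 / 59 * ‖e‖⁻¹) ^ 9 := pow_le_pow_left₀ hiea0 hiea 9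
      _ = (60 / 59 : ℝ) ^ 9 * (‖e‖⁻¹ * ‖e‖⁻¹) * ‖e‖⁻¹ ^ 7 := by ring
      _ ≤ (60 / 59 : ℝ) ^ 9 * ((25 / 23) * (25 / 23)) * ‖e‖⁻¹ ^ 7 := by gcongr
      _ = (60 / 59 : ℝ) ^ 9 * (25 / 23) ^ 2 * ‖e‖⁻¹ ^ 7 := by ring
  have he9 : ‖e‖⁻¹ ^ 9 * ‖B e + s‖ ≤ (25 / 23 : ℝ) ^ 2 * (‖B‖ + ‖s‖) * ‖e‖⁻¹ ^ 7 := by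
    have hBe' : ‖B e‖ ≤ ‖B‖ * ‖e‖ := B.le_opNorm e
    have hB0 : 0 ≤ ‖B‖ := norm_nonneg _
    calc ‖e‖⁻¹ ^ 9 * ‖B e + s‖ ≤ ‖e‖⁻¹ ^ 9 * (‖B‖ * ‖e‖ + ‖s‖) := by
          gcongr; exact (norm_add_le _ _).trans (by linarith)
      _ = ‖e‖⁻¹ ^ 7 * (‖B‖ * (‖e‖⁻¹ * (‖e‖⁻¹ * ‖e‖)) + ‖e‖⁻¹ * ‖e‖⁻¹ * ‖s‖) := by ring
      _ = ‖e‖⁻¹ ^ 7 * (‖B‖ * ‖e‖⁻¹ + ‖e‖⁻¹ * ‖e‖⁻¹ * ‖s‖) := by rw [inv_mul_cancel₀ he0.ne', mul_one]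
      _ ≤ ‖e‖⁻¹ ^ 7 * (‖B‖ * ((25 / 23) * (25 / 23)) + (25 / 23) * (25 / 23) * ‖s‖) := by
          gcongr
          calc ‖e‖⁻¹ = ‖e‖⁻¹ * 1 := (mul_one _).symm
            _ ≤ (25 / 23) * (25 / 23) := mul_le_mul hi1 (by norm_num) zero_le_one (by norm_num)
      _ = (25 / 23 : ℝ) ^ 2 * (‖B‖ + ‖s‖) * ‖e‖⁻¹ ^ 7 := by ring
  have hds : 0 ≤ ‖s' - s‖ := norm_nonneg _
  have ht1 : 6000 * ‖e + (B e + s)‖⁻¹ ^ 9 * ‖s' - s‖ ^ 2 ≤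
      6000 * ((60 / 59 : ℝ) ^ 9 * (25 / 23) ^ 2 * ‖e‖⁻¹ ^ 7) * ‖s' - s‖ ^ 2 := by gcongr
  have ht2 : 200000 * ‖e‖⁻¹ ^ 9 * ‖B e + s‖ * ‖s' - s‖ ≤
      200000 * ((25 / 23 : ℝ) ^ 2 * (‖B‖ + ‖s‖) * ‖e‖⁻¹ ^ 7) * ‖s' - s‖ := by
    refine mul_le_mul_of_nonneg_right ?_ hds
    calc 200000 * ‖e‖⁻¹ ^ 9 * ‖B e + s‖ = 200000 * (‖e‖⁻¹ ^ 9 * ‖B e + s‖) := by ring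
      _ ≤ 200000 * ((25 / 23 : ℝ) ^ 2 * (‖B‖ + ‖s‖) * ‖e‖⁻¹ ^ 7) := by gcongr
  calc ‖ℛ[e + (B e + s), s' - s] + (𝕂[e + (B e + s)] (s' - s) - 𝕂[e] (s' - s))‖
      ≤ 6000 * ‖e + (B e + s)‖⁻¹ ^ 9 * ‖s' - s‖ ^ 2 + 200000 * ‖e‖⁻¹ ^ 9 * ‖B e + s‖ * ‖s' - s‖ :=
        (norm_add_le _ _).trans (add_le_add h1 h2)
    _ ≤ 6000 * ((60 / 59 : ℝ) ^ 9 * (25 / 23) ^ 2 * ‖e‖⁻¹ ^ 7) * ‖s' - s‖ ^ 2 +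
        200000 * ((25 / 23 : ℝ) ^ 2 * (‖B‖ + ‖s‖) * ‖e‖⁻¹ ^ 7) * ‖s' - s‖ := add_le_add ht1 ht2
    _ ≤ (25 / 23 : ℝ) ^ 2 * (7200 * ‖s' - s‖ + 200000 * (‖B‖ + ‖s‖)) * ‖s' - s‖ * (‖e‖⁻¹) ^ 7 := by
        have h60 : (60 / 59 : ℝ) ^ 9 ≤ 6 / 5 := by norm_num
        have hi7 : 0 ≤ ‖e‖⁻¹ ^ 7 := by positivity
        nlinarith [mul_nonneg (mul_nonneg hi7 hds) hds, h60]

/-- **Linearisation of the natural force in the jump**: for `‖B‖ ≤ 1/200`, `‖s‖, ‖s'‖ ≤ 1/200`,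
`‖Ψ_B(s') − Ψ_B(s) − M(s' − s)‖ ≤ C₇ (25/23)² (7200‖s'−s‖ + 2·10⁵(‖B‖ + ‖s‖)) ‖s'−s‖`. [folklore] -/
theorem norm_natForce_lin_le (hA : Adm₀ A) (hI : Inner₀ t A) (hB : ‖B‖ ≤ 1 / 200) {s s' : E3}
    (hs : ‖s‖ ≤ 1 / 200) (hs' : ‖s'‖ ≤ 1 / 200) :
    ‖𝚿[B, s'] - 𝚿[B, s] - (𝐌ₓ) (s' - s)‖ ≤
      (1024 / ((23 / 25 : ℝ) ^ 3 * (23 / 25 : ℝ) ^ 4)) *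
        ((25 / 23 : ℝ) ^ 2 * (7200 * ‖s' - s‖ + 200000 * (‖B‖ + ‖s‖)) * ‖s' - s‖) := by
  have hS' := summable_natForce hA hI (hB.trans (by norm_num)) (hs'.trans (by norm_num))
  have hS := summable_natForce hA hI (hB.trans (by norm_num)) (hs.trans (by norm_num))
  have hM := summable_crossRow hA hI ⟨t 0, t0_mem_sites⟩ (s' - s)
  obtain ⟨h7, h7le⟩ := summable_inv_pow_seven_sites hA hI (t0_mem_sites (t := t) (A := A))
  rw [crossFC_apply hA hI, ← hS'.tsum_sub hS, ← (hS'.sub hS).tsum_sub hM]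
  generalize hG : (25 / 23 : ℝ) ^ 2 * (7200 * ‖s' - s‖ + 200000 * (‖B‖ + ‖s‖)) * ‖s' - s‖ = G
  have hG0 : 0 ≤ G := by rw [← hG]; positivity
  have hbd : ∀ q : Sites₀ t A,
      ‖((if (t 0 : E3) ≠ q then 𝐅[((t 0 : E3) - q) + (B ((t 0 : E3) - q) + (if (∃ z ∈ Λ₀, (q : E3) = t 1 + A z) then s' else 0))] else 0) -
        (if (t 0 : E3) ≠ q then 𝐅[((t 0 : E3) - q) + (B ((t 0 : E3) - q) + (if (∃ z ∈ Λ₀, (q : E3) = t 1 + A z) then s else 0))] else 0)) -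
        (if (∃ z ∈ Λ₀, (q : E3) = t 1 + A z) then 𝕂[(t 0 : E3) - q] (s' - s) else 0)‖ ≤
      G * (if (q : E3) ≠ t 0 then (dist (q : E3) (t 0))⁻¹ ^ 7 else 0) := by
    intro q
    by_cases hq0 : (t 0 : E3) = q
    · have hq1 : ¬ ∃ z ∈ Λ₀, (q : E3) = t 1 + A z := by
        rintro ⟨z, hz, h⟩; exact sublattice_ne hA hI zero_mem_Λ₀ hz (by simpa [hq0] using h)
      rw [if_neg (fun h => h hq0), if_neg (fun h => h hq0), if_neg hq1, if_neg (fun h => h hq0.symm)]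
      simp
    · rw [if_pos hq0, if_pos hq0, if_pos (Ne.symm hq0)]
      have he : 23 / 25 ≤ ‖(t 0 : E3) - q‖ := by
        rw [← dist_eq_norm]; exact dist_sites_ge hA hI t0_mem_sites q.2 hq0
      have hdn : dist (q : E3) (t 0) = ‖(t 0 : E3) - q‖ := by rw [dist_comm, dist_eq_norm]
      rw [hdn]
      by_cases hq1 : ∃ z ∈ Λ₀, (q : E3) = t 1 + A z
      · rw [if_pos hq1, if_pos hq1, if_pos hq1]
        have := norm_bond_lin_le (B := B) he hB hs hs'
        rw [hG] at this
        exact this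
      · rw [if_neg hq1, if_neg hq1, if_neg hq1, add_zero, sub_self, sub_zero, norm_zero]
        positivity
  calc _ ≤ ∑' q : Sites₀ t A, G * (if (q : E3) ≠ t 0 then (dist (q : E3) (t 0))⁻¹ ^ 7 else 0) :=
        tsum_of_norm_bounded (h7.mul_left G).hasSum hbd
    _ = G * ∑' q : Sites₀ t A, (if (q : E3) ≠ t 0 then (dist (q : E3) (t 0))⁻¹ ^ 7 else 0) := tsum_mul_left
    _ ≤ G * (1024 / ((23 / 25 : ℝ) ^ 3 * (23 / 25 : ℝ) ^ 4)) := by gcongr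
    _ = (1024 / ((23 / 25 : ℝ) ^ 3 * (23 / 25 : ℝ) ^ 4)) * G := mul_comm _ _

/-! ## The relaxed jump -/

/-- **Existence of the relaxed jump.**  Under harmonic stability (`0 < κ ≤ 1`), for `‖B‖ ≤ 10⁻¹⁰κ`,
`‖s₀‖ ≤ 10⁻¹⁰κ` and `‖Ψ_B(s₀)‖ ≤ 10⁻¹¹κ²`, the natural force vanishes at some jump `s` with
`‖s − s₀‖ ≤ (4/κ)‖Ψ_B(s₀)‖` (Banach fixed point for `s ↦ s − M⁻¹Ψ_B(s)`, `‖M⁻¹‖ ≤ 2/κ`). [folklore] -/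
theorem exists_natForce_zero (hA : Adm₀ A) (hI : Inner₀ t A) (hκ0 : 0 < κ) (hκ1 : κ ≤ 1)
    (hκ : ∀ v : E3 → E3, (Function.support v).Finite → Function.support v ⊆ Sites₀ t A →
      κ * nnForm t A v ≤ ∑' p : Sites₀ t A, ⟪𝕃 v @ p, v p⟫)
    (hB : ‖B‖ ≤ κ / 10 ^ 10) {s₀ : E3} (hs₀ : ‖s₀‖ ≤ κ / 10 ^ 10) (hΨ : ‖𝚿[B, s₀]‖ ≤ κ ^ 2 / 10 ^ 11) :
    ∃ s : E3, ‖s - s₀‖ ≤ 4 / κ * ‖𝚿[B, s₀]‖ ∧ 𝚿[B, s] = 0 := by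
  -- the cross force-constant operator and its inverse
  generalize hMx : (𝐌ₓ : E3 →L[ℝ] E3) = Mx
  have hcoer : ∀ β : E3, κ / 2 * ‖β‖ ^ 2 ≤ ⟪Mx β, β⟫ := fun β => by
    rw [← hMx]; exact crossFC_coercive hA hI hκ0 hκ β
  have hhalf : ∀ β : E3, κ / 2 * ‖β‖ ≤ ‖Mx β‖ := by
    intro β
    have h1 := (hcoer β).trans (real_inner_le_norm _ _)
    by_cases h0 : ‖β‖ = 0
    · rw [h0, mul_zero]; exact norm_nonneg _
    · exact le_of_mul_le_mul_right (by nlinarith [h1]) ((norm_nonneg β).lt_of_ne (Ne.symm h0))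
  have hinj : Function.Injective Mx := by
    intro x y hxy
    have h := hhalf (x - y)
    rw [map_sub, hxy, sub_self, norm_zero] at h
    have : ‖x - y‖ ≤ 0 := by nlinarith [norm_nonneg (x - y)]
    exact sub_eq_zero.1 (norm_le_zero_iff.1 this)
  set Me : E3 ≃L[ℝ] E3 := (LinearEquiv.ofInjectiveEndo Mx.toLinearMap hinj).toContinuousLinearEquiv with hMe
  have hMe' : ∀ x, Me x = Mx x := fun x => rfl
  have hright : ∀ y, Mx ((Me.symm : E3 →L[ℝ] E3) y) = y := fun y => by
    have := Me.apply_symm_apply y; rwa [hMe'] at this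
  have hleft : ∀ x, (Me.symm : E3 →L[ℝ] E3) (Mx x) = x := fun x => by
    have := Me.symm_apply_apply x; rwa [hMe'] at this
  have hMinv : ∀ y, ‖(Me.symm : E3 →L[ℝ] E3) y‖ ≤ 2 / κ * ‖y‖ := by
    intro y
    have h := hhalf ((Me.symm : E3 →L[ℝ] E3) y)
    rw [hright] at h
    calc ‖(Me.symm : E3 →L[ℝ] E3) y‖ = 2 / κ * (κ / 2 * ‖(Me.symm : E3 →L[ℝ] E3) y‖) := by
          field_simp
      _ ≤ 2 / κ * ‖y‖ := by gcongr
  have hMinv_inj : Function.Injective (Me.symm : E3 →L[ℝ] E3) := Me.symm.injective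
  -- sizes in the ball
  have hr0 : 0 ≤ 4 / κ * ‖𝚿[B, s₀]‖ := by positivity
  have hr : 4 / κ * ‖𝚿[B, s₀]‖ ≤ 4 * κ / 10 ^ 11 := by
    calc 4 / κ * ‖𝚿[B, s₀]‖ ≤ 4 / κ * (κ ^ 2 / 10 ^ 11) := by gcongr
      _ = 4 * κ / 10 ^ 11 := by field_simp
  have hball : ∀ x ∈ Metric.closedBall s₀ (4 / κ * ‖𝚿[B, s₀]‖), ‖x‖ ≤ 2 * κ / 10 ^ 10 ∧ ‖x‖ ≤ 1 / 200 := by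
    intro x hx
    rw [Metric.mem_closedBall, dist_eq_norm] at hx
    have h1 : ‖x‖ ≤ ‖x - s₀‖ + ‖s₀‖ := by
      have := norm_add_le (x - s₀) s₀; rwa [sub_add_cancel] at this
    constructor <;> nlinarith
  have hB' : ‖B‖ ≤ 1 / 200 := hB.trans (by nlinarith)
  -- the contraction estimate
  have hcontr : ∀ x ∈ Metric.closedBall s₀ (4 / κ * ‖𝚿[B, s₀]‖), ∀ y ∈ Metric.closedBall s₀ (4 / κ * ‖𝚿[B, s₀]‖),
      ‖(x - (Me.symm : E3 →L[ℝ] E3) (𝚿[B, x])) - (y - (Me.symm : E3 →L[ℝ] E3) (𝚿[B, y]))‖ ≤ 1 / 2 * ‖x - y‖ := by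
    intro x hx y hy
    obtain ⟨hxκ, hx200⟩ := hball x hx
    obtain ⟨hyκ, hy200⟩ := hball y hy
    have hxy : ‖x - y‖ ≤ 8 * κ / 10 ^ 11 := by
      rw [Metric.mem_closedBall, dist_eq_norm] at hx hy
      calc ‖x - y‖ = ‖(x - s₀) - (y - s₀)‖ := by congr 1; abel
        _ ≤ ‖x - s₀‖ + ‖y - s₀‖ := norm_sub_le _ _
        _ ≤ 8 * κ / 10 ^ 11 := by linarith
    have hid : (x - (Me.symm : E3 →L[ℝ] E3) (𝚿[B, x])) - (y - (Me.symm : E3 →L[ℝ] E3) (𝚿[B, y])) =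
        (Me.symm : E3 →L[ℝ] E3) (Mx (x - y) - (𝚿[B, x] - 𝚿[B, y])) := by
      rw [(Me.symm : E3 →L[ℝ] E3).map_sub (Mx (x - y)), hleft, (Me.symm : E3 →L[ℝ] E3).map_sub]; abel
    rw [hid]
    have hlin := norm_natForce_lin_le hA hI hB' hy200 hx200
    rw [hMx] at hlin
    have hnum : (1024 / ((23 / 25 : ℝ) ^ 3 * (23 / 25 : ℝ) ^ 4)) *
        ((25 / 23 : ℝ) ^ 2 * (7200 * ‖x - y‖ + 200000 * (‖B‖ + ‖y‖)) * ‖x - y‖) ≤ κ / 4 * ‖x - y‖ := by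
      have hc7 : (1024 / ((23 / 25 : ℝ) ^ 3 * (23 / 25 : ℝ) ^ 4)) ≤ 1840 := by norm_num
      have hc2 : (25 / 23 : ℝ) ^ 2 ≤ 119 / 100 := by norm_num
      have hin : 7200 * ‖x - y‖ + 200000 * (‖B‖ + ‖y‖) ≤ 61 / 10 ^ 6 * κ := by nlinarith
      have hxy0 : 0 ≤ ‖x - y‖ := norm_nonneg _
      calc (1024 / ((23 / 25 : ℝ) ^ 3 * (23 / 25 : ℝ) ^ 4)) *
            ((25 / 23 : ℝ) ^ 2 * (7200 * ‖x - y‖ + 200000 * (‖B‖ + ‖y‖)) * ‖x - y‖)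
          ≤ 1840 * ((119 / 100) * (61 / 10 ^ 6 * κ) * ‖x - y‖) := by
            refine mul_le_mul hc7 ?_ (by positivity) (by norm_num)
            exact mul_le_mul_of_nonneg_right (mul_le_mul hc2 hin (by positivity) (by norm_num)) hxy0
        _ ≤ κ / 4 * ‖x - y‖ := by nlinarith
    calc ‖(Me.symm : E3 →L[ℝ] E3) (Mx (x - y) - (𝚿[B, x] - 𝚿[B, y]))‖
        ≤ 2 / κ * ‖Mx (x - y) - (𝚿[B, x] - 𝚿[B, y])‖ := hMinv _
      _ = 2 / κ * ‖𝚿[B, x] - 𝚿[B, y] - Mx (x - y)‖ := by rw [← norm_neg]; congr 1; abel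
      _ ≤ 2 / κ * (κ / 4 * ‖x - y‖) := by gcongr; exact hlin.trans hnum
      _ = 1 / 2 * ‖x - y‖ := by field_simp; ring
  have hc : ‖(Me.symm : E3 →L[ℝ] E3) (𝚿[B, s₀])‖ ≤ (1 - 1 / 2) * (4 / κ * ‖𝚿[B, s₀]‖) := by
    refine (hMinv _).trans (le_of_eq ?_); ring
  obtain ⟨s, hs, h0⟩ := exists_zero_of_newton_contract (g := fun s : E3 => 𝚿[B, s]) (Me.symm : E3 →L[ℝ] E3)
    hMinv_inj hr0 (by norm_num : (0 : ℝ) ≤ 1 / 2) (by norm_num : (1 / 2 : ℝ) < 1) hcontr hc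
  refine ⟨s, ?_, h0⟩
  rwa [Metric.mem_closedBall, dist_eq_norm] at hs

end

end Summit.AtomisticToContinuum.Crystallization.Theorems.ExcessDecayLiouville

end
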